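import Summits.QuantumFields.BalabanUV.T4Continuum.Support.NE3HessShapes
import Summits.QuantumFields.BalabanUV.T4Continuum.Support.MinimalActionWitness
import HarnessLib

/-!
# T⁴ programme, node NE3 — THE LATTICE WEITZENBÖCK IDENTITY ON THE PERIODIC LATTICE, EXACT (leaf E-ML_w (w2)):
# `Σ‖∇Y‖² = Σ‖curl Y‖² + Σ‖div Y‖²` over one period of a periodic 1-form, at the FLAT background

NE3 formalisation swarm, LEAF PROVER 02 (unit `b2b-balaban-t4-ne3-formalise-leaf-02`, gen 4; cell `pub-balaban`); row
E-MLw-w2 of `t4/formal/NE3/LEAVES.md` (typer v1.44) = sub-leaf (w2) of the owner's socket (ML_w)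
`NE3EnergyWeightedShapes.WeightedTangentCoercive` (skeleton `SKELETON-NE3-P1.md` v1.9 §4b).  The flat core of (ML_w) is
(w1) `hess 1 Y Y ≥ (1/n)·‖curl Y‖²` ∧ (w2) THIS FILE ∧ (w3) block-Poincaré on `ker d(avgIter k)(1)`.

CONTENT (pure lattice vector calculus, [folklore]; 0 `def`, 0 sorry).  For a 1-form `Y : ℤ^d → (Fin d → E)` with values in a
REAL INNER-PRODUCT SPACE `E`, periodic with period `P ≥ 1` in every coordinate direction, summed over ONE PERIOD
`periodBox P = [0,P)^d` (the torus `(ℤ/Pℤ)^d` read on its cover):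

* §1 two SUMMATIONS BY PARTS on the period box (`sum_inner_fd_left`, `sum_inner_fd_right`; no boundary terms — shift
  invariance `T4AveragingDeficitWallBoundary.sum_periodBox_shift`), and the CROSS-TERM IDENTITY
  **`sum_inner_cross_eq`**: `Σ_x ⟪∂_μY_ν, ∂_νY_μ⟫ = Σ_x ⟪∂⁻_νY_ν, ∂⁻_μY_μ⟫` (forward differences `∂_μf(x) = f(x+e_μ) − f(x)`,
  backward `∂⁻_μf(x) = f(x) − f(x−e_μ)`);
* §2 ordered pairs versus planes: `Σ_μ Σ_ν g μ ν = 2·Σ_{π : Plane d} g π` for `g` symmetric with zero diagonal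
  (`sum_sum_eq_two_mul_sum_plane`; the tree counts each unoriented plaquette ONCE, `T4AveragingDeficitWall.Plane`);
* §3 **`weitzenbock_periodBox`** (THE IDENTITY):
  `Σ_{x∈[0,P)^d} Σ_μ Σ_ν ‖Y(x+e_μ)_ν − Y(x)_ν‖² = Σ_x Σ_{μ<ν} ‖(∂_μY_ν − ∂_νY_μ)(x)‖² + Σ_x ‖Σ_μ (Y(x)_μ − Y(x−e_μ)_μ)‖²`
  — gradient energy = curl energy + divergence energy, EXACTLY (the flat lattice has no curvature term); and its
  divergence-free (lattice Landau gauge) corollary `weitzenbock_periodBox_of_div_eq_zero`;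
* §4 the MATRIX-VALUED instance in the normalised Hilbert–Schmidt currency `MatrixNorms.nhsNormSq` (B12 (0.14)), with the
  tree's own objects BY NAME: the dressed curl `T4AveragingDeficitWall.curlAt` at `MinimalActionWitness.flatCfg ≡ 1` IS the flat
  lattice curl (`curlAt_flatCfg`), the backward divergence `Σ_μ (Y(x)_μ − Y(x−e_μ)_μ)` IS `NE3CoercivityScaling.flatDiv Y x`
  (by `rfl`; spelled out here so that this file imports only `NE3HessShapes` + `MinimalActionWitness`);
  **`weitzenbock_nhs_periodBox`**:
  `Σ_x Σ_μ Σ_ν nhsNormSq (Y(x+e_μ)_ν − Y(x)_ν) = Σ_x Σ_π nhsNormSq (curlAt 1 Y x π) + Σ_x nhsNormSq (Σ_μ (Y(x)_μ − Y(x−e_μ)_μ))`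
  for `IsPeriodicDir Y P`, the `plaqsOf` form, and the Landau corollary **`weitzenbock_nhs_periodBox_of_flatDiv_eq_zero`** (on
  `NE3CoercivityScaling.flatTangentLandau`'s divergence condition `flatDiv Y = 0` — definitionally the hypothesis `hdiv` —
  the gradient energy IS the curl energy); one-sided passage to the op-norm `curlSq`: `curlSq 1 Y F ≤ card n · Σ nhsNormSq (curlAt 1 Y ·)`
  (`MatrixNorms.opNorm_sq_le_card_mul_nhsNormSq`) — the identity itself is an inner-product statement (the squared
  operator norm is not a quadratic form; nothing is claimed about an operator-norm analogue).

WHY HS AND NOT THE OPERATOR NORM.  `T4AveragingDeficitWall.curlSq`/`dirSq` and `NE3EnergyWeightedShapes.energyNormW` are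
operator-norm sums (scope `Matrix.Norms.L2Operator`); an exact quadratic identity needs an inner product.  The (ML_w) flat
assembly runs in `nhsNormSq` (where `hess 1 Y Y` is EXACTLY the curl energy for skew `Y`, (w1)) and descends to the
operator norm at the end by `nhsNormSq ≤ ‖·‖² ≤ card n · nhsNormSq` — whence the owner's `c_w(flat) = 1/(n(1 + C_P))`.

HONEST FRAMING.  An exact identity of discrete vector calculus at ONE (flat) configuration — OUR proof frame, not a
printed statement (context only: [Balaban1984PropagatorsI] (1.21)/(1.69) «Δ = ∂*∂ + ∂∂*» on the unit lattice; the
abstract operator form is the NE2 row's `LatticeWeitzenbock.weitzenbock_of_commute`, of which this is the concrete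
periodic-torus, normed, plane-counted instance the NE3 sockets consume).  Not (ML_w) (needs (w1), (w3), (w4)); nothing
about minimisers; NE3 NOT proved; spine PROVED 0/9; finite T⁴ rung (B)+1 — NOT infinite volume, NOT mass gap, NOT
`BetaPertH`, NOT Clay.  HONEST DEPENDENCY: continuum YM on T⁴ ⇐ BetaPertH ∧ nine spine estimates (0/9 proved);
BetaPertH ⇐ (D1) ∧ (D4) ∧ CAP+tail; G-an2-4 gates asym, D1 and NE2/3/4.  ABSOLUTE RULE kept: no printed sentence is a
hypothesis; no `def … : Prop`.  PLACEMENT: our work, `Summits/QuantumFields/BalabanUV/`; imports accepted modules only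
(`Support.NE3HessShapes`, `Support.MinimalActionWitness`).
-/

set_option autoImplicit false

open scoped BigOperators Matrix Matrix.Norms.L2Operator InnerProductSpace
open Finset

namespace Summit.QuantumFields.BalabanUV.T4Continuum.NE3LatticeWeitzenbock

open Literature.MathematicalPhysics.QuantumFieldTheory.Balaban1983to89
open B7Prop1Explicit (Site e e_apply)
open T4AveragingDeficitWall (curlAt curl curlSq Ad)
open T4AveragingDeficitWallBoundary (periodBox sum_periodBox_shift)
open AveragingDeficitPeriodicCounting (IsPeriodicDir)
open MinimalActionWitness (flatCfg)
open MatrixNorms (nhsNormSq nhsNormSq_nonneg opNorm_sq_le_card_mul_nhsNormSq)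
open NE3HessShapes (plaqsOf sum_plaqsOf)

noncomputable section

variable {d : ℕ}

/-! ## §1 Summation by parts on the period box and the cross-term identity -/

section InnerProduct

variable {E : Type*} [NormedAddCommGroup E] [InnerProductSpace ℝ E]

/-- **SUMMATION BY PARTS, forward difference on the left**: for `P`-periodic `f, g` and the period box `[0,P)^d`,
`Σ_x ⟪f(x+e_μ) − f(x), g(x)⟫ = −Σ_x ⟪f(x), g(x) − g(x−e_μ)⟫` (no boundary term on the torus). [folklore] -/
theorem sum_inner_fd_left {P : ℕ} (hP : 1 ≤ P) {f g : Site d → E}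
    (hf : ∀ (x : Site d) (κ : Fin d), f (x + (P : ℤ) • e κ) = f x)
    (hg : ∀ (x : Site d) (κ : Fin d), g (x + (P : ℤ) • e κ) = g x) (μ : Fin d) :
    ∑ x ∈ periodBox P, ⟪f (x + e μ) - f x, g x⟫_ℝ = -∑ x ∈ periodBox P, ⟪f x, g x - g (x - e μ)⟫_ℝ := by
  have hshift : ∑ x ∈ periodBox P, ⟪f (x + e μ), g x⟫_ℝ = ∑ x ∈ periodBox P, ⟪f x, g (x - e μ)⟫_ℝ := by
    have h := sum_periodBox_shift (d := d) P hP (g := fun x => ⟪f x, g (x - e μ)⟫_ℝ) (fun x κ => by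
      rw [hf, show x + (P : ℤ) • e κ - e μ = x - e μ + (P : ℤ) • e κ by abel, hg]) (e μ)
    simpa only [add_sub_cancel_right] using h
  simp only [inner_sub_left, inner_sub_right, Finset.sum_sub_distrib, hshift]
  ring

/-- **SUMMATION BY PARTS, difference on the right**: `Σ_x ⟪f x, g(x+e_μ) − g x⟫ = −Σ_x ⟪f x − f(x−e_μ), g x⟫`. [folklore] -/
theorem sum_inner_fd_right {P : ℕ} (hP : 1 ≤ P) {f g : Site d → E}
    (hf : ∀ (x : Site d) (κ : Fin d), f (x + (P : ℤ) • e κ) = f x)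
    (hg : ∀ (x : Site d) (κ : Fin d), g (x + (P : ℤ) • e κ) = g x) (μ : Fin d) :
    ∑ x ∈ periodBox P, ⟪f x, g (x + e μ) - g x⟫_ℝ = -∑ x ∈ periodBox P, ⟪f x - f (x - e μ), g x⟫_ℝ := by
  have hshift : ∑ x ∈ periodBox P, ⟪f x, g (x + e μ)⟫_ℝ = ∑ x ∈ periodBox P, ⟪f (x - e μ), g x⟫_ℝ := by
    have h := sum_periodBox_shift (d := d) P hP (g := fun x => ⟪f (x - e μ), g x⟫_ℝ) (fun x κ => by
      rw [hg, show x + (P : ℤ) • e κ - e μ = x - e μ + (P : ℤ) • e κ by abel, hf]) (e μ)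
    simpa only [add_sub_cancel_right] using h
  simp only [inner_sub_left, inner_sub_right, Finset.sum_sub_distrib, hshift]
  ring

/-- **THE CROSS-TERM IDENTITY** (two summations by parts and the commutation of lattice differences): for a
`P`-periodic 1-form `Y` and every pair of directions `μ, ν`,
`Σ_x ⟪Y(x+e_μ)_ν − Y(x)_ν, Y(x+e_ν)_μ − Y(x)_μ⟫ = Σ_x ⟪Y(x)_ν − Y(x−e_ν)_ν, Y(x)_μ − Y(x−e_μ)_μ⟫`. [folklore] -/
theorem sum_inner_cross_eq {P : ℕ} (hP : 1 ≤ P) {Y : Site d → Fin d → E}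
    (hY : ∀ (x : Site d) (κ μ : Fin d), Y (x + (P : ℤ) • e κ) μ = Y x μ) (μ ν : Fin d) :
    ∑ x ∈ periodBox P, ⟪Y (x + e μ) ν - Y x ν, Y (x + e ν) μ - Y x μ⟫_ℝ
      = ∑ x ∈ periodBox P, ⟪Y x ν - Y (x - e ν) ν, Y x μ - Y (x - e μ) μ⟫_ℝ := by
  -- first summation by parts: move `∂_μ` off the left factor
  have h1 := sum_inner_fd_left (d := d) hP (f := fun x => Y x ν) (g := fun x => Y (x + e ν) μ - Y x μ)
    (fun x κ => hY x κ ν) (fun x κ => by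
      rw [show x + (P : ℤ) • e κ + e ν = x + e ν + (P : ℤ) • e κ by abel, hY, hY]) μ
  -- the difference quotient of `g` is a forward difference in `ν` of the backward difference `∂⁻_μ Y_μ`
  have h2 : ∀ x : Site d, (Y (x + e ν) μ - Y x μ) - (Y (x - e μ + e ν) μ - Y (x - e μ) μ)
      = (Y (x + e ν) μ - Y (x + e ν - e μ) μ) - (Y x μ - Y (x - e μ) μ) := by
    intro x
    rw [show x - e μ + e ν = x + e ν - e μ by abel]
    abel
  -- second summation by parts: move `∂_ν` onto the left factor
  have h3 := sum_inner_fd_right (d := d) hP (f := fun x => Y x ν) (g := fun x => Y x μ - Y (x - e μ) μ)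
    (fun x κ => hY x κ ν) (fun x κ => by
      rw [show x + (P : ℤ) • e κ - e μ = x - e μ + (P : ℤ) • e κ by abel, hY, hY]) ν
  rw [h1]
  simp only [h2]
  rw [h3, neg_neg]

/-- Summing the cross-term identity over all ordered pairs gives THE DIVERGENCE ENERGY:
`Σ_x Σ_μ Σ_ν ⟪∂_μY_ν, ∂_νY_μ⟫ = Σ_x ‖Σ_μ (Y(x)_μ − Y(x−e_μ)_μ)‖²`. [folklore] -/
theorem sum_sum_inner_cross_eq_divSq {P : ℕ} (hP : 1 ≤ P) {Y : Site d → Fin d → E}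
    (hY : ∀ (x : Site d) (κ μ : Fin d), Y (x + (P : ℤ) • e κ) μ = Y x μ) :
    ∑ x ∈ periodBox P, ∑ μ : Fin d, ∑ ν : Fin d, ⟪Y (x + e μ) ν - Y x ν, Y (x + e ν) μ - Y x μ⟫_ℝ
      = ∑ x ∈ periodBox P, ‖∑ μ : Fin d, (Y x μ - Y (x - e μ) μ)‖ ^ 2 := by
  calc ∑ x ∈ periodBox P, ∑ μ : Fin d, ∑ ν : Fin d, ⟪Y (x + e μ) ν - Y x ν, Y (x + e ν) μ - Y x μ⟫_ℝ
      = ∑ μ : Fin d, ∑ ν : Fin d, ∑ x ∈ periodBox P, ⟪Y (x + e μ) ν - Y x ν, Y (x + e ν) μ - Y x μ⟫_ℝ := by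
        rw [Finset.sum_comm]
        exact Finset.sum_congr rfl fun μ _ => Finset.sum_comm
    _ = ∑ μ : Fin d, ∑ ν : Fin d, ∑ x ∈ periodBox P, ⟪Y x ν - Y (x - e ν) ν, Y x μ - Y (x - e μ) μ⟫_ℝ := by
        simp only [sum_inner_cross_eq hP hY]
    _ = ∑ x ∈ periodBox P, ∑ μ : Fin d, ∑ ν : Fin d, ⟪Y x ν - Y (x - e ν) ν, Y x μ - Y (x - e μ) μ⟫_ℝ := by
        rw [eq_comm, Finset.sum_comm]
        exact Finset.sum_congr rfl fun μ _ => Finset.sum_comm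
    _ = ∑ x ∈ periodBox P, ‖∑ μ : Fin d, (Y x μ - Y (x - e μ) μ)‖ ^ 2 := by
        refine Finset.sum_congr rfl fun x _ => ?_
        rw [← real_inner_self_eq_norm_sq, inner_sum]
        exact Finset.sum_congr rfl fun μ _ => (sum_inner _ _ _).symm

/-! ## §2 Ordered pairs versus planes -/

omit [InnerProductSpace ℝ E] in
/-- For `g` symmetric with zero diagonal, the sum over ORDERED pairs of directions is twice the sum over the planes
`μ < ν` (the tree's `T4AveragingDeficitWall.Plane d` counts each unoriented plaquette once). [folklore] -/
theorem sum_sum_eq_two_mul_sum_plane (g : Fin d → Fin d → ℝ) (hdiag : ∀ μ, g μ μ = 0)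
    (hsymm : ∀ μ ν, g μ ν = g ν μ) :
    ∑ μ : Fin d, ∑ ν : Fin d, g μ ν = 2 * ∑ π : T4AveragingDeficitWall.Plane d, g π.1.1 π.1.2 := by
  classical
  have hsplit : ∀ μ ν : Fin d, g μ ν = (if μ < ν then g μ ν else 0) + (if ν < μ then g μ ν else 0) := by
    intro μ ν
    rcases lt_trichotomy μ ν with h | h | h
    · simp [h, lt_asymm h]
    · subst h; simp [hdiag]
    · simp [h, lt_asymm h]
  have hupper : ∑ μ : Fin d, ∑ ν : Fin d, (if μ < ν then g μ ν else 0) = ∑ π : T4AveragingDeficitWall.Plane d, g π.1.1 π.1.2 := by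
    rw [← Fintype.sum_prod_type' (f := fun μ ν : Fin d => if μ < ν then g μ ν else 0),
      ← Finset.sum_filter]
    exact Finset.sum_subtype _ (fun a => by simp) (fun a : Fin d × Fin d => g a.1 a.2)
  have hlower : ∑ μ : Fin d, ∑ ν : Fin d, (if ν < μ then g μ ν else 0)
      = ∑ μ : Fin d, ∑ ν : Fin d, (if μ < ν then g μ ν else 0) := by
    calc ∑ μ : Fin d, ∑ ν : Fin d, (if ν < μ then g μ ν else 0)
        = ∑ μ : Fin d, ∑ ν : Fin d, (if ν < μ then g ν μ else 0) :=
          Finset.sum_congr rfl fun μ _ => Finset.sum_congr rfl fun ν _ => by rw [hsymm μ ν]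
      _ = ∑ μ : Fin d, ∑ ν : Fin d, (if μ < ν then g μ ν else 0) := Finset.sum_comm
  calc ∑ μ : Fin d, ∑ ν : Fin d, g μ ν
      = ∑ μ : Fin d, ∑ ν : Fin d, ((if μ < ν then g μ ν else 0) + (if ν < μ then g μ ν else 0)) :=
        Finset.sum_congr rfl fun μ _ => Finset.sum_congr rfl fun ν _ => hsplit μ ν
    _ = 2 * ∑ π : T4AveragingDeficitWall.Plane d, g π.1.1 π.1.2 := by
        simp only [Finset.sum_add_distrib]
        rw [hlower, hupper]
        ring

/-! ## §3 The identity -/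

/-- Pointwise expansion of the curl energy at one site: `2·Σ_{μ<ν} ‖∂_μY_ν − ∂_νY_μ‖² =
2·Σ_μ Σ_ν ‖∂_μY_ν‖² − 2·Σ_μ Σ_ν ⟪∂_μY_ν, ∂_νY_μ⟫`. [folklore] -/
theorem two_mul_sum_plane_curl_sq (Y : Site d → Fin d → E) (x : Site d) :
    2 * ∑ π : T4AveragingDeficitWall.Plane d, ‖(Y (x + e π.1.1) π.1.2 - Y x π.1.2) - (Y (x + e π.1.2) π.1.1 - Y x π.1.1)‖ ^ 2
      = 2 * ∑ μ : Fin d, ∑ ν : Fin d, ‖Y (x + e μ) ν - Y x ν‖ ^ 2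
        - 2 * ∑ μ : Fin d, ∑ ν : Fin d, ⟪Y (x + e μ) ν - Y x ν, Y (x + e ν) μ - Y x μ⟫_ℝ := by
  rw [← sum_sum_eq_two_mul_sum_plane
    (fun μ ν => ‖(Y (x + e μ) ν - Y x ν) - (Y (x + e ν) μ - Y x μ)‖ ^ 2)
    (fun μ => by simp) (fun μ ν => by rw [norm_sub_rev])]
  simp only [norm_sub_sq_real (Y (x + e _) _ - Y x _) (Y (x + e _) _ - Y x _), Finset.sum_add_distrib,
    Finset.sum_sub_distrib, ← Finset.mul_sum]
  have hswap : ∑ μ : Fin d, ∑ ν : Fin d, ‖Y (x + e ν) μ - Y x μ‖ ^ 2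
      = ∑ μ : Fin d, ∑ ν : Fin d, ‖Y (x + e μ) ν - Y x ν‖ ^ 2 := Finset.sum_comm
  rw [hswap]
  ring

/-- **THE LATTICE WEITZENBÖCK IDENTITY ON THE PERIODIC LATTICE (exact)**: for a 1-form `Y` with values in a real
inner-product space, periodic with period `P ≥ 1`, summed over one period `[0,P)^d`:
GRADIENT ENERGY `Σ_x Σ_μ Σ_ν ‖Y(x+e_μ)_ν − Y(x)_ν‖²` = CURL ENERGY `Σ_x Σ_{μ<ν} ‖(∂_μY_ν − ∂_νY_μ)(x)‖²`
+ DIVERGENCE ENERGY `Σ_x ‖Σ_μ (Y(x)_μ − Y(x−e_μ)_μ)‖²` (forward curl, backward divergence; no curvature term on the flat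
lattice). [folklore] -/
theorem weitzenbock_periodBox {P : ℕ} (hP : 1 ≤ P) {Y : Site d → Fin d → E}
    (hY : ∀ (x : Site d) (κ μ : Fin d), Y (x + (P : ℤ) • e κ) μ = Y x μ) :
    ∑ x ∈ periodBox P, ∑ μ : Fin d, ∑ ν : Fin d, ‖Y (x + e μ) ν - Y x ν‖ ^ 2
      = ∑ x ∈ periodBox P, ∑ π : T4AveragingDeficitWall.Plane d,
          ‖(Y (x + e π.1.1) π.1.2 - Y x π.1.2) - (Y (x + e π.1.2) π.1.1 - Y x π.1.1)‖ ^ 2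
        + ∑ x ∈ periodBox P, ‖∑ μ : Fin d, (Y x μ - Y (x - e μ) μ)‖ ^ 2 := by
  have hkey : 2 * ∑ x ∈ periodBox P, ∑ π : T4AveragingDeficitWall.Plane d,
        ‖(Y (x + e π.1.1) π.1.2 - Y x π.1.2) - (Y (x + e π.1.2) π.1.1 - Y x π.1.1)‖ ^ 2
      = 2 * ∑ x ∈ periodBox P, ∑ μ : Fin d, ∑ ν : Fin d, ‖Y (x + e μ) ν - Y x ν‖ ^ 2
        - 2 * ∑ x ∈ periodBox P, ∑ μ : Fin d, ∑ ν : Fin d,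
            ⟪Y (x + e μ) ν - Y x ν, Y (x + e ν) μ - Y x μ⟫_ℝ := by
    simp only [Finset.mul_sum (s := periodBox P), ← Finset.sum_sub_distrib]
    exact Finset.sum_congr rfl fun x _ => two_mul_sum_plane_curl_sq Y x
  rw [sum_sum_inner_cross_eq_divSq hP hY] at hkey
  linarith

/-- **LANDAU (divergence-free) COROLLARY**: if `Σ_μ (Y(x)_μ − Y(x−e_μ)_μ) = 0` at every site, the gradient energy
IS the curl energy. [folklore] -/
theorem weitzenbock_periodBox_of_div_eq_zero {P : ℕ} (hP : 1 ≤ P) {Y : Site d → Fin d → E}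
    (hY : ∀ (x : Site d) (κ μ : Fin d), Y (x + (P : ℤ) • e κ) μ = Y x μ)
    (hdiv : ∀ x : Site d, ∑ μ : Fin d, (Y x μ - Y (x - e μ) μ) = 0) :
    ∑ x ∈ periodBox P, ∑ μ : Fin d, ∑ ν : Fin d, ‖Y (x + e μ) ν - Y x ν‖ ^ 2
      = ∑ x ∈ periodBox P, ∑ π : T4AveragingDeficitWall.Plane d,
          ‖(Y (x + e π.1.1) π.1.2 - Y x π.1.2) - (Y (x + e π.1.2) π.1.1 - Y x π.1.1)‖ ^ 2 := by
  rw [weitzenbock_periodBox hP hY]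
  simp [hdiv]

/-- The curl energy never exceeds the gradient energy (drop the divergence term). [folklore] -/
theorem sum_plane_curl_sq_le_sum_grad_sq {P : ℕ} (hP : 1 ≤ P) {Y : Site d → Fin d → E}
    (hY : ∀ (x : Site d) (κ μ : Fin d), Y (x + (P : ℤ) • e κ) μ = Y x μ) :
    ∑ x ∈ periodBox P, ∑ π : T4AveragingDeficitWall.Plane d,
        ‖(Y (x + e π.1.1) π.1.2 - Y x π.1.2) - (Y (x + e π.1.2) π.1.1 - Y x π.1.1)‖ ^ 2
      ≤ ∑ x ∈ periodBox P, ∑ μ : Fin d, ∑ ν : Fin d, ‖Y (x + e μ) ν - Y x ν‖ ^ 2 := by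
  rw [weitzenbock_periodBox hP hY]
  have : 0 ≤ ∑ x ∈ periodBox P, ‖∑ μ : Fin d, (Y x μ - Y (x - e μ) μ)‖ ^ 2 := by positivity
  linarith

/-- The divergence energy never exceeds the gradient energy (drop the curl term). [folklore] -/
theorem sum_div_sq_le_sum_grad_sq {P : ℕ} (hP : 1 ≤ P) {Y : Site d → Fin d → E}
    (hY : ∀ (x : Site d) (κ μ : Fin d), Y (x + (P : ℤ) • e κ) μ = Y x μ) :
    ∑ x ∈ periodBox P, ‖∑ μ : Fin d, (Y x μ - Y (x - e μ) μ)‖ ^ 2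
      ≤ ∑ x ∈ periodBox P, ∑ μ : Fin d, ∑ ν : Fin d, ‖Y (x + e μ) ν - Y x ν‖ ^ 2 := by
  rw [weitzenbock_periodBox hP hY]
  have : 0 ≤ ∑ x ∈ periodBox P, ∑ π : T4AveragingDeficitWall.Plane d,
      ‖(Y (x + e π.1.1) π.1.2 - Y x π.1.2) - (Y (x + e π.1.2) π.1.1 - Y x π.1.1)‖ ^ 2 := by positivity
  linarith

end InnerProduct

/-! ## §4 The matrix-valued instance: the tree's dressed curl at the flat configuration and the backward divergence
(`NE3CoercivityScaling.flatDiv`, by `rfl`), in the normalised Hilbert–Schmidt currency -/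

section Matrix

variable {n : Type*} [Fintype n] [DecidableEq n]

/-- **AT THE FLAT CONFIGURATION THE DRESSED CURL IS THE FLAT LATTICE CURL**: `(d_1 Y)(x; μ, ν) = ∂_μY_ν(x) − ∂_νY_μ(x)`
(all parallel transports are `1`). [folklore] -/
theorem curlAt_flatCfg (Y : Site d → Fin d → Matrix n n ℂ) (x : Site d) (μ ν : Fin d) :
    curlAt (flatCfg (d := d) (n := n)) Y x μ ν = (Y (x + e μ) ν - Y x ν) - (Y (x + e ν) μ - Y x μ) := by
  simp only [curlAt, MinimalActionWitness.flatCfg, mul_one, inv_one, Ad, Units.val_one, one_mul]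
  abel

omit [DecidableEq n] in
/-- The normalised Hilbert–Schmidt norm squared is the entry sum over `n × n` divided by `card n`. [folklore] -/
theorem nhsNormSq_eq_sum_prod (X : Matrix n n ℂ) :
    nhsNormSq X = (∑ q : n × n, ‖X q.1 q.2‖ ^ 2) / Fintype.card n := by
  rw [nhsNormSq, Fintype.sum_prod_type' (fun i j => ‖X i j‖ ^ 2)]

omit [Fintype n] [DecidableEq n] in
/-- A periodic matrix-valued direction field has periodic entries. [folklore] -/
theorem isPeriodicDir_apply {P : ℕ} {Y : Site d → Fin d → Matrix n n ℂ} (hY : IsPeriodicDir Y P) (q : n × n)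
    (x : Site d) (κ μ : Fin d) : Y (x + (P : ℤ) • e κ) μ q.1 q.2 = Y x μ q.1 q.2 := by
  rw [hY x κ μ]

/-- **THE LATTICE WEITZENBÖCK IDENTITY FOR MATRIX-VALUED PERIODIC DIRECTION FIELDS, ENTRYWISE (Hilbert–Schmidt)**:
`Σ_x Σ_μ Σ_ν Σ_{ij} |(Y(x+e_μ)_ν − Y(x)_ν)_{ij}|² = Σ_x Σ_π Σ_{ij} |(d_1 Y)(x;π)_{ij}|² + Σ_x Σ_{ij} |(Σ_μ (Y(x)_μ − Y(x−e_μ)_μ))_{ij}|²`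
over one period, for `IsPeriodicDir Y P`, `P ≥ 1` — with the tree's `curlAt flatCfg` BY NAME (the divergence sum is
`NE3CoercivityScaling.flatDiv Y x` by `rfl`). [folklore] -/
theorem weitzenbock_entry_periodBox {P : ℕ} (hP : 1 ≤ P) {Y : Site d → Fin d → Matrix n n ℂ}
    (hY : IsPeriodicDir Y P) :
    ∑ x ∈ periodBox P, ∑ μ : Fin d, ∑ ν : Fin d, ∑ q : n × n, ‖(Y (x + e μ) ν - Y x ν) q.1 q.2‖ ^ 2
      = ∑ x ∈ periodBox P, ∑ π : T4AveragingDeficitWall.Plane d, ∑ q : n × n, ‖(curlAt (flatCfg (d := d) (n := n)) Y x π.1.1 π.1.2) q.1 q.2‖ ^ 2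
        + ∑ x ∈ periodBox P, ∑ q : n × n, ‖(∑ μ : Fin d, (Y x μ - Y (x - e μ) μ)) q.1 q.2‖ ^ 2 := by
  simp only [curlAt_flatCfg, Matrix.sub_apply, Matrix.sum_apply]
  -- move the entry sum outermost on every term
  simp only [Finset.sum_comm (t := (Finset.univ : Finset (n × n)))]
  rw [← Finset.sum_add_distrib]
  exact Finset.sum_congr rfl fun q _ =>
    weitzenbock_periodBox (E := ℂ) hP (Y := fun x μ => Y x μ q.1 q.2) (isPeriodicDir_apply hY q)

/-- **THE SAME IN THE NORMALISED HILBERT–SCHMIDT CURRENCY `nhsNormSq`** (B12 (0.14); the currency in which the flat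
Wilson Hessian is EXACTLY the curl energy, leaf (w1)):
`Σ_x Σ_μ Σ_ν nhsNormSq (Y(x+e_μ)_ν − Y(x)_ν) = Σ_x Σ_π nhsNormSq ((d_1 Y)(x; π)) + Σ_x nhsNormSq (∑ μ : Fin d, (Y x μ - Y (x - e μ) μ))`. [folklore] -/
theorem weitzenbock_nhs_periodBox {P : ℕ} (hP : 1 ≤ P) {Y : Site d → Fin d → Matrix n n ℂ}
    (hY : IsPeriodicDir Y P) :
    ∑ x ∈ periodBox P, ∑ μ : Fin d, ∑ ν : Fin d, nhsNormSq (Y (x + e μ) ν - Y x ν)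
      = ∑ x ∈ periodBox P, ∑ π : T4AveragingDeficitWall.Plane d, nhsNormSq (curlAt (flatCfg (d := d) (n := n)) Y x π.1.1 π.1.2)
        + ∑ x ∈ periodBox P, nhsNormSq (∑ μ : Fin d, (Y x μ - Y (x - e μ) μ)) := by
  simp only [nhsNormSq_eq_sum_prod, ← Finset.sum_div]
  rw [weitzenbock_entry_periodBox hP hY, add_div]

/-- The `plaqsOf` form of the curl energy (the window `periodBox P ×ˢ univ` of `NE3HessForm.hess`). [folklore] -/
theorem sum_plaqsOf_nhsNormSq_curl (Y : Site d → Fin d → Matrix n n ℂ) (F : Finset (Site d)) :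
    ∑ p ∈ plaqsOf F, nhsNormSq (curl (flatCfg (d := d) (n := n)) Y p)
      = ∑ x ∈ F, ∑ π : T4AveragingDeficitWall.Plane d, nhsNormSq (curlAt (flatCfg (d := d) (n := n)) Y x π.1.1 π.1.2) := by
  rw [sum_plaqsOf]
  rfl

/-- **THE IDENTITY IN THE `plaqsOf` FORM**:
`Σ_x Σ_μ Σ_ν nhsNormSq (∂_μY_ν(x)) = Σ_{p ∈ plaqsOf [0,P)^d} nhsNormSq ((d_1 Y)(p)) + Σ_x nhsNormSq (∑ μ : Fin d, (Y x μ - Y (x - e μ) μ))`. [folklore] -/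
theorem weitzenbock_nhs_plaqsOf {P : ℕ} (hP : 1 ≤ P) {Y : Site d → Fin d → Matrix n n ℂ}
    (hY : IsPeriodicDir Y P) :
    ∑ x ∈ periodBox P, ∑ μ : Fin d, ∑ ν : Fin d, nhsNormSq (Y (x + e μ) ν - Y x ν)
      = ∑ p ∈ plaqsOf (periodBox P), nhsNormSq (curl (flatCfg (d := d) (n := n)) Y p)
        + ∑ x ∈ periodBox P, nhsNormSq (∑ μ : Fin d, (Y x μ - Y (x - e μ) μ)) := by
  rw [sum_plaqsOf_nhsNormSq_curl, weitzenbock_nhs_periodBox hP hY]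

/-- **LANDAU COROLLARY (the divergence condition of `NE3CoercivityScaling.flatTangentLandau`, `flatDiv Y x = 0`, which is
`hdiv` by `rfl`)**: for a periodic backward-divergence-free direction field THE GRADIENT ENERGY IS THE CURL ENERGY:
`Σ_x Σ_μ Σ_ν nhsNormSq (∂_μY_ν(x)) = Σ_x Σ_π nhsNormSq ((d_1 Y)(x; π))`. [folklore] -/
theorem weitzenbock_nhs_periodBox_of_flatDiv_eq_zero {P : ℕ} (hP : 1 ≤ P) {Y : Site d → Fin d → Matrix n n ℂ}
    (hY : IsPeriodicDir Y P) (hdiv : ∀ x : Site d, ∑ μ : Fin d, (Y x μ - Y (x - e μ) μ) = 0) :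
    ∑ x ∈ periodBox P, ∑ μ : Fin d, ∑ ν : Fin d, nhsNormSq (Y (x + e μ) ν - Y x ν)
      = ∑ x ∈ periodBox P, ∑ π : T4AveragingDeficitWall.Plane d, nhsNormSq (curlAt (flatCfg (d := d) (n := n)) Y x π.1.1 π.1.2) := by
  rw [weitzenbock_nhs_periodBox hP hY]
  simp [hdiv, nhsNormSq]

/-- … and in the `plaqsOf` form. [folklore] -/
theorem weitzenbock_nhs_plaqsOf_of_flatDiv_eq_zero {P : ℕ} (hP : 1 ≤ P) {Y : Site d → Fin d → Matrix n n ℂ}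
    (hY : IsPeriodicDir Y P) (hdiv : ∀ x : Site d, ∑ μ : Fin d, (Y x μ - Y (x - e μ) μ) = 0) :
    ∑ x ∈ periodBox P, ∑ μ : Fin d, ∑ ν : Fin d, nhsNormSq (Y (x + e μ) ν - Y x ν)
      = ∑ p ∈ plaqsOf (periodBox P), nhsNormSq (curl (flatCfg (d := d) (n := n)) Y p) := by
  rw [sum_plaqsOf_nhsNormSq_curl, weitzenbock_nhs_periodBox_of_flatDiv_eq_zero hP hY hdiv]

/-- Without the divergence condition the curl energy is still AT MOST the gradient energy. [folklore] -/
theorem sum_nhsNormSq_curl_le_grad {P : ℕ} (hP : 1 ≤ P) {Y : Site d → Fin d → Matrix n n ℂ}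
    (hY : IsPeriodicDir Y P) :
    ∑ x ∈ periodBox P, ∑ π : T4AveragingDeficitWall.Plane d, nhsNormSq (curlAt (flatCfg (d := d) (n := n)) Y x π.1.1 π.1.2)
      ≤ ∑ x ∈ periodBox P, ∑ μ : Fin d, ∑ ν : Fin d, nhsNormSq (Y (x + e μ) ν - Y x ν) := by
  rw [weitzenbock_nhs_periodBox hP hY]
  have : 0 ≤ ∑ x ∈ periodBox P, nhsNormSq (∑ μ : Fin d, (Y x μ - Y (x - e μ) μ)) := Finset.sum_nonneg fun x _ => nhsNormSq_nonneg _
  linarith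

/-- … and so is the divergence energy. [folklore] -/
theorem sum_nhsNormSq_flatDiv_le_grad {P : ℕ} (hP : 1 ≤ P) {Y : Site d → Fin d → Matrix n n ℂ}
    (hY : IsPeriodicDir Y P) :
    ∑ x ∈ periodBox P, nhsNormSq (∑ μ : Fin d, (Y x μ - Y (x - e μ) μ))
      ≤ ∑ x ∈ periodBox P, ∑ μ : Fin d, ∑ ν : Fin d, nhsNormSq (Y (x + e μ) ν - Y x ν) := by
  rw [weitzenbock_nhs_periodBox hP hY]
  have : 0 ≤ ∑ x ∈ periodBox P, ∑ π : T4AveragingDeficitWall.Plane d, nhsNormSq (curlAt (flatCfg (d := d) (n := n)) Y x π.1.1 π.1.2) :=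
    Finset.sum_nonneg fun x _ => Finset.sum_nonneg fun π _ => nhsNormSq_nonneg _
  linarith

/-! ### One-sided passage to the operator-norm functionals of the wall files -/

/-- **OPERATOR-NORM CURL ENERGY ≤ `card n` × HS CURL ENERGY** at the flat configuration, on any site set:
`curlSq 1 Y F ≤ card n · Σ_{x∈F} Σ_π nhsNormSq ((d_1 Y)(x; π))` (`MatrixNorms.opNorm_sq_le_card_mul_nhsNormSq` termwise).
[folklore] -/
theorem curlSq_flatCfg_le_card_mul (Y : Site d → Fin d → Matrix n n ℂ) (F : Finset (Site d)) :
    curlSq (flatCfg (d := d) (n := n)) Y F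
      ≤ Fintype.card n * ∑ x ∈ F, ∑ π : T4AveragingDeficitWall.Plane d, nhsNormSq (curlAt (flatCfg (d := d) (n := n)) Y x π.1.1 π.1.2) := by
  rw [curlSq, Finset.mul_sum]
  refine Finset.sum_le_sum fun x _ => ?_
  rw [Finset.mul_sum]
  exact Finset.sum_le_sum fun π _ => opNorm_sq_le_card_mul_nhsNormSq _

/-- **OPERATOR-NORM BOND ENERGY ≤ `card n` × HS BOND ENERGY**: `dirSq Y F ≤ card n · Σ_x Σ_κ nhsNormSq (Y x κ)`. [folklore] -/
theorem dirSq_le_card_mul (Y : Site d → Fin d → Matrix n n ℂ) (F : Finset (Site d)) :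
    T4AveragingDeficitWall.dirSq Y F ≤ Fintype.card n * ∑ x ∈ F, ∑ κ : Fin d, nhsNormSq (Y x κ) := by
  rw [T4AveragingDeficitWall.dirSq, Finset.mul_sum]
  refine Finset.sum_le_sum fun x _ => ?_
  rw [Finset.mul_sum]
  exact Finset.sum_le_sum fun κ _ => opNorm_sq_le_card_mul_nhsNormSq _

/-- **HS GRADIENT ENERGY ≤ OPERATOR-NORM GRADIENT ENERGY** (`nhsNormSq ≤ ‖·‖²`): the other one-sided passage, for a
consumer who measures `∇Y` in the operator norm. [folklore] -/
theorem sum_nhsNormSq_grad_le_opNorm (Y : Site d → Fin d → Matrix n n ℂ) (F : Finset (Site d)) :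
    ∑ x ∈ F, ∑ μ : Fin d, ∑ ν : Fin d, nhsNormSq (Y (x + e μ) ν - Y x ν)
      ≤ ∑ x ∈ F, ∑ μ : Fin d, ∑ ν : Fin d, ‖Y (x + e μ) ν - Y x ν‖ ^ 2 :=
  Finset.sum_le_sum fun _ _ => Finset.sum_le_sum fun _ _ => Finset.sum_le_sum fun _ _ =>
    MatrixNorms.nhsNormSq_le_opNorm_sq _

end Matrix

end

end Summit.QuantumFields.BalabanUV.T4Continuum.NE3LatticeWeitzenbock
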